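import Summits.ABC.IUTFork.Joshi.ATS4VojtaBoundedDegree
import Summits.ABC.IUTFork.Joshi.ATS4MainTheorem
import Summits.ABC.IUTFork.Joshi.ATS4ExistenceLemmasCurves
import Summits.ABC.IUTFork.Joshi.ATS4SecondMainBound
import Summits.ABC.IUTFork.Joshi.ATS4MainBounds
import Literature.IUT.LogVolume.Corollary22OfThm110
import HarnessLib

/-!
# [J-IV] §7, companion: Thm 7.1.1 (general display), Thm 7.2.1 verbatim, Rmk 7.1.12, and §7.1's inputs with
# Lem 5.8.7 / Prop 5.6.1 DISCHARGED by name — the ONE residual of §7 is Thm 6.1.1 at the point (TYPED, NOT asserted)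

Block E of the abc-iut cell (rung LADDER-ABC:A2.E), seat abc-iut-E-t33, slot T-33; nodes J4:Thm7.1.1, J4:Rmk7.1.12,
J4:Thm7.2.1 (plan/E/JOSHI-DAG.tsv). SOURCE: K. Joshi, *Construction of Arithmetic Teichmüller Spaces IV: Proof of the
abc-conjecture*, arXiv:2403.10430**v2** (unrefereed; bib `Joshi2024ATS4`), §7 = PDF pp.72–75 («p.N l.a–b» = page/lines of
the cell's render `HOME/lit/renders/Joshi-arxiv-2403.10430/`). Companion of `Joshi/ATS4VojtaBoundedDegree.lean` (same seat:
`Thm711Reduced`, the elementary chain `Thm711.*`, `vojtaP1Deg_of_thm711Reduced`, `abc_of_thm711Reduced`), binding BY NAME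
to T-24's `Joshi/ATS4Statements.lean` / `ATS4MainTheorem.lean` (Conj 2.1.1/2.2.1/2.5.1, `CurveHeightDatum`, `MainTheorem`),
T-29's `Joshi/ATS4ExistenceLemmasCurves.lean` (`IsLem587Prime` = «a prime ℓ given by Lemma 5.8.7» at the point, DISCHARGED
there by `exists_isLem587Prime`; E-t29's `ATS4VojtaInputsSupply.lean` reaches `Thm711Reduced` from the tree's [IUTchIV]
Thm 1.10 interface `Cor22.Thm110Legendre` + `IsEtaPrm 60` — one level below the residual typed here).
FRAMING (binding): this file TYPES a third party's unrefereed text; it takes NO side on [IUTchIII] Cor 3.12, on Joshi's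
claims, or on Mochizuki's report on them, and makes NO abc claim: Joshi's assertions are `Prop`-valued `def`s tagged
`@[claim "Joshi2024ATS4" "disputed"]`, never axioms/instances/`sorry`/Literature facts; every `theorem` is DERIVED
bookkeeping or an IMPLICATION from named claims. Typed ≠ proved; typed AS A CANDIDATE ≠ endorsed.

WHAT IS HERE.
1. **The inputs of §7.1 after the faithfulness repair F6** (self-reported on `ATS4VojtaBoundedDegree.lean`: its
   `PointInputs.emod_le_dmod` types the printed «`e*_mod ≤ d_mod`» (p.73 l.33–34) literally, which with `e*_mod =
   2^12·3^3·5·e_mod` ([J-IV] §4.1.1 (5); T-30's `MainBoundDatum.estar`; [IUTchIV] Thm 1.10) is not satisfiable at honest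
   values for `d < 2^12·3^3·5`; what p.73 l.33–64 USES is `e*_mod ≤ δ` and `20·d_mod ≤ δ`). `PointInputs`/`Thm711Inputs` are
   SUPERSEDED by: `Thm611Consumed d P ℓ` = Thm 6.1.1's first inequality with `d_mod`, `e*_mod` replaced by their bounds
   `d`, `δ` (the substitution p.73 l.33–35 performs; E-t29's `pointInputs_estar_forces` is the kernel form of the
   defect) and `Thm611OnLambdaLine D d` = «outside an exceptional set of bounded
   height (p.73 l.9–13) every `C_λ` carries a prime `ℓ` of Lemma 5.8.7 (T-29's `IsLem587Prime`, by name) at which that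
   bound holds» — the single residual Prop of §7. DISCHARGED on the way: (7.1.2) from Lem 5.8.7 (3)
   (`eq712_of_isLem587Prime`, tree `Cor22.logQAvoid_sub_insert_le`); Prop 5.6.1 = [IUTchIV] Cor 2.2 (i) = tree THEOREM
   `Cor22.partI_holds`; the «`Q^{1/2} < ξ_prm` ⟹ enlarge `Exc`» step (p.54 l.23–26) (`thm611OnLambdaLine_of`). Net kernel
   statement: `thm711Reduced_of_thm611OnLambdaLine` and `thm721_of_thm611OnLambdaLine` — **§7 follows from Thm 6.1.1 at
   the point alone** (Thm 6.1.1 = [IUTchIV] Thm 1.10, which rests on the disputed Cor 3.12: slot T-30 / E4).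
2. **Thm 7.1.1, general display** (p.72 l.65–69) over T-24's carrier: `Thm711 𝔛` (= `MainTheorem 𝔛` verbatim, §7.2's first
   sentence: `thm711_iff_mainTheorem`); at the tripod it is `Thm711Reduced` (`thm711Reduced_iff_strongAbcConjecture`,
   `thm711Reduced_of_thm711`).
3. **Thm 7.2.1 verbatim** (p.75 l.29–30): `Thm721 := AbcConjecture ∧ ArithmeticSzpiroConjecture` (T-24's ℤ-form 2.1.1 and
   2.2.1), `thm721_iff : Thm721 ↔ ABC ∧ SzpiroConjecture`, `abc_of_thm721`, `thm721_of_thm711Reduced`, `thm721_of_thm711`.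
4. **Bridge**: OUR [IUTchIV] Cor 2.2 typing gives Joshi's reduced 7.1.1 (`thm711Reduced_of_corollary22`). (The bridge from
   T-30's verbatim `MainBoundDatum.Thm611` to `Thm611Consumed` — `e*_mod = 2^12·3^3·5·e_mod ≤ δ` from `e_mod ≤ d_mod ≤ d`,
   `coeff` monotone in `d_mod` — is a 10-line follow-up once `Joshi/ATS4MainBounds` is built on the farm.)
5. **Rmk 7.1.12** (p.75 l.21–26): `ExcTateBound`, `Rmk7112` (claim), `excTateBound_of_partII` (the attribution to [IUTchIV]
   Cor 2.2 (ii), checked against the tree's `Cor22.PartII`). FLAG (F7, ref-x): Joshi merges [IUTchIV] Cor 2.2's two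
   exceptional sets (`Exc_d` of (ii), `Exc_{ε,d}` of (iii)) into one bound `H_unif·ε^{−3}·d^{4+ε} + H_Z` — typed as printed;
   «can also be arrived at from the proof given above» is NOT derived (the threshold lemmas bound `Q` on the enlargements
   without the `ε^{−3}·d^{4+ε}` shape).
6. (appended) **Junctions BY NAME**: `thm611Consumed_iff_thm611Ineq` (E-t4's `ATS4.Thm611Ineq` — the E4 → E5 hand-over —
   IS `Thm611Consumed`, `Iff.rfl`), `thm611Consumed_of_thm611Ineq` (honest `d_mod ≤ d`, `e*_mod ≤ δ`),
   `abcOnCompactlyBoundedSubsets_two_of_thm711Reduced` (the shape `ATS4StatementsCor22Bridge` asks of T-33), `thm711_tripod_iff`.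
7. (appended) `thm611Consumed_of_mainBoundDatum` (T-30's verbatim `MainBoundDatum.Thm611` ⟹ `Thm611Consumed` under the dictionary
   identifications), `thm711Reduced_of_thm110Legendre_cor22Route` / `thm721_of_thm110Legendre` (the tree's [IUTchIV] Thm 1.10
   interface `Cor22.Thm110Legendre` ALONE ⟹ reduced Thm 7.1.1 ⟹ Thm 7.2.1, via the tree's Cor 2.2 ⟹ Cor 2.3 route).
DICTIONARY: as in `ATS4VojtaBoundedDegree.lean` (`Tate ↦ Cor22.logQForall`, `Tate₂ ↦ logQNotTwo`, `log(q) ↦ logQAvoid P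
{2,ℓ}`, `δ ↦ Cor22.delta d`, `Z ↦ CBData` + `Cor22.Hypotheses`, `U(Q̄)_{≤d} ↦ UPle d`, `≲/≈ ↦ BDLe/BDEquiv`). R14: no
`Cor312*`/`Thm311*` import.
-/

noncomputable section

universe u v

namespace Summit.ABC.IUTFork.Joshi.ATS4

open Literature.NumberTheory.DiophantineGeometry Literature.NumberTheory.DiophantineGeometry.GenEll
open Literature.NumberTheory.EllipticCurves
open Literature.IUT.LogVolume Literature.IUT.LogVolume.Cor22

/-! ## 1. §7.1's per-point input after F6; (7.1.2) and Prop 5.6.1 discharged; the residual `Thm611OnLambdaLine` -/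

/-- **Thm 6.1.1, first inequality, AS CONSUMED by §7.1 at the curve `C_λ` with its prime `ℓ`** (display p.58 l.4–16 /
p.73 l.13–25: "`(1/6)·log(q) ≤ (1 + 20·d_mod/ℓ)·(log(𝔡^{L_tpd}) + log(𝔣^{L_tpd})) + 20(e*_mod·ℓ + 60)`", after "using …
`e*_mod ≤ d_mod ≤ δ`" (p.73 l.33–35; FLAG F6: what is used is `d_mod ≤ d`, `e*_mod ≤ δ = 2^12·3^3·5·d`) — i.e. with
`d_mod ↦ d`, `e*_mod ↦ δ`): implied by Thm 6.1.1 as printed (`e_mod ≤ d_mod ≤ d`; T-30's `MainBoundDatum.Thm611`), implies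
the display p.73 l.55–64. `log(q) ↦ Cor22.logQAvoid P {2, ℓ}`, `log 𝔡 + log 𝔣 ↦ logDiff + logCond`. Thm 6.1.1 = [IUTchIV] Thm 1.10
with `η_prm = 60` (rests on Cor 3.12). HYPOTHESIS-shaped CLAIM; NOT asserted. -/
@[claim "Joshi2024ATS4" "disputed"]
def Thm611Consumed (d : ℕ) (P : NFPoint) (ℓ : ℕ) : Prop :=
  1 / 6 * logQAvoid P {2, ℓ} ≤ (1 + 20 * (d : ℝ) / ℓ) * (P.logDiff + P.logCond) + 20 * (delta d * ℓ + 60)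

/-- **(7.1.2), first inequality, DISCHARGED** (p.73 l.65–74: "by definition `Q₂ = Tate₂(C_λ)` and `Q = Tate(C_λ)` and
Lemma 5.8.7 one has `(1/6)·Tate₂(C_λ) − (1/6)·q ≤ (1/6)·Q^{1/2}·log(ℓ)`"): for a prime `ℓ` of Lemma 5.8.7 at the point
(T-29's `IsLem587Prime`, clause (3) `a_v < Q^{1/2}` at `v | ℓ`), the `ℓ`-part of the Tate divisor is `≤ Q^{1/2}·log ℓ`
(tree `Cor22.logQAvoid_sub_insert_le`, as in T-29's `ineq5810_holds`). PROVED. [folklore] -/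
theorem eq712_of_isLem587Prime {d : ℕ} {P : NFPoint} {ℓ : ℕ} (hℓ : IsLem587Prime d P ℓ) :
    1 / 6 * logQNotTwo P - 1 / 6 * logQAvoid P {2, ℓ} ≤ 1 / 6 * Real.sqrt (logQForall P) * Real.log ℓ := by
  haveI : Fact ℓ.Prime := ⟨hℓ.1⟩
  have h := logQAvoid_sub_insert_le P {2} hℓ.1 (Real.sqrt_nonneg (logQForall P)) (fun v hv hlv =>
    (hℓ.2.2.2.2 v hv ((mem_placesOver_iff_residueChar v).mp (mem_placesOver_of_natCast_mem ℓ v hlv))).le)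
  rw [Finset.pair_comm] at h
  show 1 / 6 * logQAvoid P {2} - _ ≤ _
  linarith

/-- **(7.1.3) at `C_λ`** (p.73 l.33–93) from a prime `ℓ` of Lemma 5.8.7, `Q^{1/2} ≥ 5` (p.54 l.27–28), Thm 6.1.1 as
consumed, and the Prop 5.6.1 constant `A_Z` — via `Thm711.ineq713` with `d_mod ↦ d`, `e*_mod ↦ δ`. PROVED. [folklore] -/
theorem ineq713_of_thm611Consumed {d : ℕ} {P : NFPoint} {ℓ : ℕ} (hd : 0 < d) (hℓ : IsLem587Prime d P ℓ)
    (h5 : 5 ≤ Real.sqrt (logQForall P)) (h611 : Thm611Consumed d P ℓ) {A : ℝ}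
    (hA : 1 / 6 * logQForall P - 1 / 6 * logQNotTwo P ≤ A) :
    1 / 6 * logQForall P ≤ (1 + delta d / Real.sqrt (logQForall P)) * (P.logDiff + P.logCond)
      + (15 * delta d) ^ 2 * Real.sqrt (logQForall P) * Real.log (2 * delta d * logQForall P) + (1200 + A) := by
  have hδ := one_le_delta hd
  have h0 : (0 : ℝ) ≤ d := by positivity
  have hdm : 20 * (d : ℝ) ≤ delta d := by unfold delta; nlinarith
  exact Thm711.ineq713 (Real.mul_self_sqrt (logQAvoid_nonneg P ∅)) h5 hδ hdm le_rfl
    (add_nonneg P.logDiff_nonneg P.logCond_nonneg) hℓ.2.1 hℓ.2.2.1 h611 (eq712_of_isLem587Prime hℓ) hA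

/-- **The residual of §7 on `Z ∩ U(Q̄)_{≤d}`: Thm 5.7.1 + Thm 6.1.1 AS CONSUMED by §7.1** (p.73 l.9–13, verbatim:
"Consider an elliptic curve `C_λ` given by Theorem 5.7.1 and let `Exc` be the set constructed in the proof of Theorem
5.7.1. This curve satisfies all the conditions of Theorem 6.1.1 and the set for `x_λ ∈ Exc`, the height is bounded by some
constant depending on `d`, `Z`. … For `C_λ ∉ Exc`, the estimate provided by Theorem 6.1.1 holds."): an exceptional set of
bounded height, and off it a prime `ℓ` of Lemma 5.8.7 (T-29's `IsLem587Prime`) at which Thm 6.1.1's consumed bound holds.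
SUPERSEDES `Thm711Inputs` (F6; Prop 5.6.1 is no longer a field: it is the tree theorem `Cor22.partI_holds`). The E5 answer
to "what E4 feeds": THIS Prop. CLAIM-shaped hypothesis; NOT asserted. -/
@[claim "Joshi2024ATS4" "disputed"]
def Thm611OnLambdaLine (D : CBData) (d : ℕ) : Prop :=
  ∃ Exc : Set NFPoint, (∃ H : ℝ, ∀ P ∈ Exc, P.ht ≤ H) ∧
    ∀ P ∈ D.toSet ∩ UPle d, P ∉ Exc → ∃ ℓ : ℕ, IsLem587Prime d P ℓ ∧ Thm611Consumed d P ℓ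

/-- **§7.1 with its classical inputs discharged**: for `Z` with (5.6.2) (`Cor22.Hypotheses`), `d ≥ 1`, `ε > 0`,
`Thm611OnLambdaLine Z d` gives (7.1.11) "`h_{ω_{ℙ¹}(D)} ≤ (1+ε)·(log-diff_{ℙ¹} + log-con_D) + A_Z` on `Z ∩ U(Q̄)_{≤d}`", i.e.
`VojtaIneq Z d ε`. Prop 5.6.1 enters as the THEOREM `Cor22.partI_holds` (`A_Z`, p.73 l.75–79; `h ≈ (1/6)Q`, p.75 l.11–12);
curves with `Q^{1/2} < 5` are handled like `Exc` (their height is bounded by Prop 5.6.1); off `Exc`: `ineq713_of_…` then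
`Thm711.ineq719_uniform` ((7.1.4)–(7.1.9) incl. the three "enlarge `Exc`" moves). PROVED. [folklore] -/
theorem vojtaIneq_of_thm611OnLambdaLine {D : CBData} (hD : Hypotheses D) {d : ℕ} (hd : 0 < d)
    (h : Thm611OnLambdaLine D d) {ε : ℝ} (hε : 0 < ε) : VojtaIneq D.toSet d ε := by
  obtain ⟨Exc, ⟨H, hH⟩, hoff⟩ := h
  obtain ⟨⟨AZ, hAZ⟩, h23, h34⟩ := partI_holds D hD
  obtain ⟨C₀, hC₀⟩ := (h34.symm.trans h23.symm).bdLe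
  have hδ : 0 < delta d := lt_of_lt_of_le one_pos (one_le_delta hd)
  obtain ⟨A, hA⟩ := Thm711.ineq719_uniform hδ (by positivity : (0 : ℝ) < (15 * delta d) ^ 2) hε (1200 + AZ)
  refine ⟨|H| + |A| + |C₀| + 25 / 6, fun P hP => ?_⟩
  have hLD : 0 ≤ P.logDiff + P.logCond := add_nonneg P.logDiff_nonneg P.logCond_nonneg
  have hεLD : 0 ≤ (1 + ε) * (P.logDiff + P.logCond) := mul_nonneg (by linarith) hLD
  have hht := hC₀ P hP.1; dsimp only at hht
  by_cases hPE : P ∈ Exc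
  · linarith [hH P hPE, le_abs_self H, abs_nonneg A, abs_nonneg C₀]
  obtain ⟨ℓ, hℓ, h611⟩ := hoff P hP hPE
  have hQ0 : 0 ≤ logQForall P := logQAvoid_nonneg P ∅
  by_cases h5 : 5 ≤ Real.sqrt (logQForall P)
  · have hAZP : 1 / 6 * logQForall P - 1 / 6 * logQNotTwo P ≤ AZ := by
      have := hAZ P hP.1; dsimp only at this
      rw [abs_sub_comm] at this; exact (le_abs_self _).trans this
    have h719 := hA (logQForall P) _ hQ0 hLD (ineq713_of_thm611Consumed hd hℓ h5 h611 hAZP)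
    linarith [le_abs_self A, le_abs_self C₀, abs_nonneg H]
  · have hQ : logQForall P < 25 := by
      nlinarith [Real.mul_self_sqrt hQ0, Real.sqrt_nonneg (logQForall P), not_le.mp h5]
    linarith [abs_nonneg A, le_abs_self C₀, abs_nonneg H]

/-- **"Q^{1/2} < ξ_prm ⟹ enlarge Exc" is free** (p.54 l.23–26: "there are finitely many elliptic curves for which `Q^{1/2} ≤
ξ_prm`. This says, by Proposition 5.6.1, that the height of `C_λ` is bounded …"): to establish `Thm611OnLambdaLine Z d` it
suffices to serve the curves with `ξ ≤ Q^{1/2}` off a bounded-height `Exc₀` — the others join the exceptional set with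
height `≤ ξ²/6 + C` by `Cor22.partI_holds`. (For `ξ = ξ_prm`, T-29's `exists_isLem587Prime` then supplies `ℓ`; only Thm
6.1.1 at that `ℓ` remains.) PROVED. [folklore] -/
theorem thm611OnLambdaLine_of {D : CBData} (hD : Hypotheses D) {d : ℕ} {ξ : ℝ} (Exc₀ : Set NFPoint)
    (hExc₀ : ∃ H : ℝ, ∀ P ∈ Exc₀, P.ht ≤ H)
    (h : ∀ P ∈ D.toSet ∩ UPle d, P ∉ Exc₀ → ξ ≤ Real.sqrt (logQForall P) →
      ∃ ℓ : ℕ, IsLem587Prime d P ℓ ∧ Thm611Consumed d P ℓ) :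
    Thm611OnLambdaLine D d := by
  obtain ⟨_, h23, h34⟩ := partI_holds D hD
  obtain ⟨C₀, hC₀⟩ := (h34.symm.trans h23.symm).bdLe
  obtain ⟨H, hH⟩ := hExc₀
  refine ⟨Exc₀ ∪ {P | P ∈ D.toSet ∧ Real.sqrt (logQForall P) < ξ}, ⟨max H (1 / 6 * ξ ^ 2 + C₀), ?_⟩, ?_⟩
  · rintro P (hP | ⟨hPD, hPξ⟩)
    · exact (hH P hP).trans (le_max_left _ _)
    · have hht := hC₀ P hPD; dsimp only at hht
      have h0 : 0 ≤ logQForall P := logQAvoid_nonneg P ∅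
      have hξ0 : 0 ≤ ξ := (Real.sqrt_nonneg _).trans hPξ.le
      have hQ : logQForall P ≤ ξ ^ 2 := by
        nlinarith [Real.mul_self_sqrt h0, Real.sqrt_nonneg (logQForall P)]
      exact le_trans (by linarith) (le_max_right _ _)
  · intro P hP hPE
    simp only [Set.mem_union, Set.mem_setOf_eq, not_or, not_and, not_lt] at hPE
    exact h P hP hPE.1 (hPE.2 hP.1)

/-- **Thm 7.1.1 (reduced) from the §7 residual alone** (p.75 l.20 "This proves Theorem 7.1.1"): if Thm 5.7.1 / 6.1.1 as
consumed hold on every `Z` with (5.6.2) and every `d ≥ 1`, then `Thm711Reduced`. PROVED as an implication. [folklore] -/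
theorem thm711Reduced_of_thm611OnLambdaLine
    (h : ∀ D : CBData, Hypotheses D → ∀ d : ℕ, 0 < d → Thm611OnLambdaLine D d) : Thm711Reduced :=
  fun D hD d hd _ hε => vojtaIneq_of_thm611OnLambdaLine hD hd (h D hD d hd) hε

/-! ## 2. Thm 7.1.1, general display (p.72 l.65–69), over T-24's carrier; its tripod instance is `Thm711Reduced` -/

/-- **[J-IV] Theorem 7.1.1** (p.72 l.64–69, verbatim): "This is the main theorem of this paper. Theorem 7.1.1. Let `X` be a
geometrically connected, smooth, projective curve over a number field `L`. Let `D ⊂ X` be a reduced divisor, let `U_X =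
X − D`. Assume `U_X` is a hyperbolic curve. Let `d ∈ ℕ`. Let `ε > 0`. Then one has the inequality `h_{ω_X(D)} ≲ (1 +
ε)(log-diff_X + log-con_D)` holds on `U_X(Q̄)_{≤d}`." Typed on a family of T-24's curve data (the genuine family of all
hyperbolic `(X, D)/L` is not constructible in the tree; `CurveHeightDatum` is T-24's interim carrier) — the SAME display
as Thm 2.10.1 (`thm711_iff_mainTheorem`), here WITH the hyperbolicity hypothesis restated (T-24's note (a) on 2.10.1).
[J-IV] p.10: = Joshi's [IUTchIV] Cor 2.3. CLAIM (disputed, unrefereed); NOT asserted; NO abc claim. -/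
@[claim "Joshi2024ATS4" "disputed"]
def Thm711 {ι : Type v} (𝔛 : ι → CurveHeightDatum.{u}) : Prop :=
  ∀ i, (𝔛 i).VojtaHeightInequality

/-- **§7.2, first sentence** (p.75 l.28): "From Theorem 7.1.1 one obtains Theorem 2.10.1" — the two displays coincide
verbatim (T-24's `MainTheorem`). [folklore] -/
theorem thm711_iff_mainTheorem {ι : Type v} (𝔛 : ι → CurveHeightDatum.{u}) : Thm711 𝔛 ↔ MainTheorem 𝔛 := Iff.rfl

/-- The reduced form of Thm 7.1.1 (compactly bounded `Z` with (5.6.2)) is EQUIVALENT to the strong abc-conjecture 2.6.1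
(T-24's `StrongAbcConjecture` = `∀ d ≥ 1, VojtaP1Deg d`) — unconditionally, both reductions being tree theorems
(`Cor22.jInvVacuous_holds`, `GenEll_thm21_primes_holds`). PROVED; an equivalence of statements. [folklore] -/
theorem thm711Reduced_iff_strongAbcConjecture : Thm711Reduced ↔ StrongAbcConjecture :=
  ⟨fun h _ hd => vojtaP1Deg_of_thm711Reduced h hd, thm711Reduced_of_vojtaP1Deg⟩

/-- … equivalently, to Conj 2.5.1 / Thm 7.1.1 for the tripod datum `(ℙ¹_ℚ, {0,1,∞})`. PROVED. [folklore] -/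
theorem thm711Reduced_iff_tripod : Thm711Reduced ↔ CurveHeightDatum.tripod.VojtaHeightInequality :=
  thm711Reduced_iff_strongAbcConjecture.trans vojtaHeightInequality_tripod_iff.symm

/-- Thm 7.1.1 on any family containing the tripod gives its reduced form. PROVED as an implication. [folklore] -/
theorem thm711Reduced_of_thm711 {ι : Type v} (𝔛 : ι → CurveHeightDatum.{1}) (i₀ : ι)
    (h₀ : 𝔛 i₀ = CurveHeightDatum.tripod) (h : Thm711 𝔛) : Thm711Reduced := by
  rw [thm711Reduced_iff_tripod, ← h₀]; exact h i₀

/-! ## 3. Thm 7.2.1 verbatim (p.75 l.27–30) -/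

/-- **[J-IV] Theorem 7.2.1** (p.75 l.27–30, verbatim): "7.2 Proof of Theorem 2.10.1. From Theorem 7.1.1 one obtains
Theorem 2.10.1. In particular: Theorem 7.2.1. The abc-conjecture (Conjecture 2.1.1) and the arithmetic Szpiro conjecture
over ℚ are true." = T-24's verbatim `AbcConjecture` (2.1.1, ℤ-form) ∧ `ArithmeticSzpiroConjecture` (2.2.1). A CLAIM of an
unrefereed preprint, rejected by the IUT author (Mochizuki2024JoshiReport) and accepted by neither side of the dispute;
typed as a named `Prop`, NEVER asserted — THIS CAMPAIGN MAKES NO abc CLAIM; B3 (plan/repair/CANDIDATES.tsv RP-J0x)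
black-boxes it as a hypothesis. Its kernel relation to OUR summit statement is `thm721_iff` / `abc_of_thm721`. -/
@[claim "Joshi2024ATS4" "disputed"]
def Thm721 : Prop := AbcConjecture ∧ ArithmeticSzpiroConjecture

/-- Thm 7.2.1 as typed IS `ABC ∧ SzpiroConjecture` of the tree (T-24's `abcConjecture_iff_ABC`,
`arithmeticSzpiroConjecture_iff`). PROVED; an equivalence of statements, nothing asserted. [folklore] -/
theorem thm721_iff : Thm721 ↔ ABC ∧ SzpiroConjecture := and_congr abcConjecture_iff_ABC arithmeticSzpiroConjecture_iff

/-- **Thm 7.2.1-as-typed ⟹ OUR summit statement `ABC`** (definitional up to T-24's proved `↔`). An implication from a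
disputed claim; NO abc claim. [folklore] -/
theorem abc_of_thm721 (h : Thm721) : ABC := abcConjecture_iff_ABC.mp h.1

/-- **§7.2 "From Theorem 7.1.1 … In particular: Theorem 7.2.1"** in kernel: the reduced Thm 7.1.1 implies Thm 7.2.1
(`abc_of_thm711Reduced`, `szpiro_of_thm711Reduced`). An implication between claims; nothing asserted. [folklore] -/
theorem thm721_of_thm711Reduced (h : Thm711Reduced) : Thm721 :=
  ⟨abcConjecture_iff_ABC.mpr (abc_of_thm711Reduced h), arithmeticSzpiroConjecture_iff.mpr (szpiro_of_thm711Reduced h)⟩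

/-- §7.2 for the general display: Thm 7.1.1 on any family containing the tripod implies Thm 7.2.1. [folklore] -/
theorem thm721_of_thm711 {ι : Type v} (𝔛 : ι → CurveHeightDatum.{1}) (i₀ : ι)
    (h₀ : 𝔛 i₀ = CurveHeightDatum.tripod) (h : Thm711 𝔛) : Thm721 :=
  thm721_of_thm711Reduced (thm711Reduced_of_thm711 𝔛 i₀ h₀ h)

/-- **§7 end to end**: the §7 residual (Thm 5.7.1 / 6.1.1 as consumed, on every `Z`, `d`) implies Thm 7.2.1, hence `ABC`
(`abc_of_thm721`). PROVED AS AN IMPLICATION; its hypothesis rests on the disputed Cor 3.12; NO abc claim. [folklore] -/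
theorem thm721_of_thm611OnLambdaLine
    (h : ∀ D : CBData, Hypotheses D → ∀ d : ℕ, 0 < d → Thm611OnLambdaLine D d) : Thm721 :=
  thm721_of_thm711Reduced (thm711Reduced_of_thm611OnLambdaLine h)

/-! ## 4. Bridge: OUR typing of [IUTchIV] Cor 2.2 gives Joshi's reduced Thm 7.1.1 -/

/-- [J-IV] p.10 / Rmk 2.10.2: "[Mochizuki, 2021d, Corollary 2.3] = Theorem 7.1.1". In kernel, over the tree's typing
`Cor22.Corollary22 H_unif` of [IUTchIV] Cor 2.2 (a HYPOTHESIS, resting on Cor 3.12): (i)+(ii)+(iii) give the reduced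
Thm 7.1.1 (`Cor22.vojtaIneq_of_corollary22`, the proof of Cor 2.3 p.55). An implication; nothing asserted. [folklore] -/
theorem thm711Reduced_of_corollary22 {Hunif : ℝ} (h22 : Corollary22 Hunif) : Thm711Reduced :=
  fun D hD _ hd _ hε => by
    obtain ⟨hI, hII, hIII⟩ := h22.2 D hD
    exact vojtaIneq_of_corollary22 hI hII hIII hd hε

/-! ## 5. Remark 7.1.12 (p.75 l.21–26) -/

/-- The displayed bound of Rmk 7.1.12 on a set `Exc`: "`Tate ≲ H_unif·ε^{−3}·d^{4+ε} + H_Z`" on `Exc` (read `≤`, the right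
side being a constant; `Tate ↦ Cor22.logQForall`). Compare [IUTchIV] Cor 2.2 (ii) in `Cor22.PartII` ("`log(q^∀) ≤
H_unif·ε_d^{−3}·d^{4+ε_d} + H_K` on `Exc_d`") and (iii) in `Cor22.PartIII` (FLAG F7). [claim: Joshi2024ATS4, status: disputed] -/
def ExcTateBound (Exc : Set NFPoint) (d : ℕ) (ε Hunif HZ : ℝ) : Prop :=
  ∀ P ∈ Exc, logQForall P ≤ Hunif * ε ^ (-(3 : ℝ)) * (d : ℝ) ^ (4 + ε) + HZ

/-- **[J-IV] Rmk 7.1.12** (p.75 l.21–26, verbatim): "In the notation of Theorem 5.7.1, let `Z` be the given compactly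
bounded subset. Then in [Mochizuki, 2021d, Corollary 2.2], Mochizuki shows that on `Exc`, the function `Tate` satisfies
`Tate ≲ H_unif·ε^{−3}·d^{4+ε} + H_Z` for some positive constant `H_unif` which is independent of `Z`, while `H_Z` is a
positive constant dependent on `Z`. This conclusion can also be arrived at from the proof given above." Typed: a uniform
`H_unif > 0` such that for every `Z` (with (5.6.2)), `d ≥ 1`, `0 < ε ≤ 1` an exceptional set SERVING §7.1 (bounded height;
off it a Lem-5.8.7 prime with Thm 6.1.1's consumed bound) obeys the bound for some `H_Z > 0`. The last sentence is NOT
derived (FLAG F7). CLAIM; NOT asserted. -/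
@[claim "Joshi2024ATS4" "disputed"]
def Rmk7112 : Prop :=
  ∃ Hunif : ℝ, 0 < Hunif ∧ ∀ D : CBData, Hypotheses D → ∀ d : ℕ, 0 < d → ∀ ε : ℝ, 0 < ε → ε ≤ 1 →
    ∃ Exc : Set NFPoint, ∃ HZ : ℝ, 0 < HZ ∧ ExcTateBound Exc d ε Hunif HZ ∧ (∃ H : ℝ, ∀ P ∈ Exc, P.ht ≤ H) ∧
      ∀ P ∈ D.toSet ∩ UPle d, P ∉ Exc → ∃ ℓ : ℕ, IsLem587Prime d P ℓ ∧ Thm611Consumed d P ℓ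

/-- The attribution in Rmk 7.1.12, checked against the tree's typing: [IUTchIV] Cor 2.2 (ii) (`Cor22.PartII D H_unif`, a
HYPOTHESIS) gives, for `d ≥ 1` and `0 < ε ≤ 1` (taken as its `ε_d`), an exceptional set `Exc_d ⊆ U(Q̄)_{≤d}` on which
`Tate = log(q^∀) ≤ H_unif·ε^{−3}·d^{4+ε} + H_K` — the displayed shape. PROVED (bookkeeping). [folklore] -/
theorem excTateBound_of_partII {D : CBData} {Hunif : ℝ} (h : PartII D Hunif) {d : ℕ} (hd : 0 < d) {ε : ℝ}
    (hε : 0 < ε) (hε1 : ε ≤ 1) :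
    ∃ Exc : Set NFPoint, Exc ⊆ UPle d ∧ ∃ HZ : ℝ, 0 < HZ ∧ ExcTateBound Exc d ε Hunif HZ := by
  obtain ⟨_, HK, _, hHK, h⟩ := h
  obtain ⟨Exc, -, hsub, -, hB, -⟩ := h d hd ε hε hε1
  exact ⟨Exc, hsub, HK, hHK, fun P hP => hB P hP⟩

/-! ## 6. Junctions BY NAME (appended): E-t4's `Thm611Ineq` (the E4 → E5 hand-over) and T-24's §2 shapes -/

/-- **E4 → E5 junction, in kernel**: `Thm611Consumed d P ℓ` IS E-t4's `ATS4.Thm611Ineq` (`ATS4SecondMainBound.lean`: "Thm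
6.1.1's conclusion, SHAPE ONLY … the target the chain below descends to", i.e. what [J-III] Cor 9.11.1.1 ⟹ Thm 6.10.1 ⟹
`C_Θ ≥ −1` ⟹ Thm 6.1.1 delivers) evaluated at `ℓ`, `log q = Cor22.logQAvoid P {2, ℓ}`, `log 𝔡 = logDiff`, `log 𝔣 = logCond`,
`d_mod ↦ d`, `e*_mod ↦ δ` — by `Iff.rfl`. [folklore] -/
theorem thm611Consumed_iff_thm611Ineq (d : ℕ) (P : NFPoint) (ℓ : ℕ) :
    Thm611Consumed d P ℓ ↔ Thm611Ineq (ℓ : ℝ) (logQAvoid P {2, ℓ}) P.logDiff P.logCond d (delta d) := Iff.rfl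

/-- The same junction with the honest degrees: E-t4's `Thm611Ineq` at `(ℓ, log q, log 𝔡, log 𝔣, d_mod, e*_mod)` with `d_mod ≤ d`
and `e*_mod ≤ δ` (F6: `e*_mod = 2^12·3^3·5·e_mod`, `e_mod ≤ d_mod ≤ d`) implies `Thm611Consumed d P ℓ` — the coefficient
`1 + 20·d_mod/ℓ` and the term `20·e*_mod·ℓ` being monotone. PROVED. [folklore] -/
theorem thm611Consumed_of_thm611Ineq {d : ℕ} {P : NFPoint} {ℓ : ℕ} (hℓ : 0 < ℓ) {dmod estar : ℝ} (hdmod : dmod ≤ d)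
    (hestar : estar ≤ delta d) (h : Thm611Ineq (ℓ : ℝ) (logQAvoid P {2, ℓ}) P.logDiff P.logCond dmod estar) :
    Thm611Consumed d P ℓ := by
  unfold Thm611Ineq at h
  unfold Thm611Consumed
  have hℓ' : (0 : ℝ) < ℓ := by exact_mod_cast hℓ
  have hLD : 0 ≤ P.logDiff + P.logCond := add_nonneg P.logDiff_nonneg P.logCond_nonneg
  have hc : 20 * dmod / ℓ ≤ 20 * (d : ℝ) / ℓ := div_le_div_of_nonneg_right (by linarith) hℓ'.le
  have h2 := mul_le_mul_of_nonneg_right hc hLD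
  have h3 := mul_le_mul_of_nonneg_right hestar hℓ'.le
  nlinarith [h, h2, h3]

/-- **The shape T-24's `ATS4StatementsCor22Bridge.lean` asks of T-33**: the reduced Thm 7.1.1 delivers Joshi's Thm 2.8.1 (2)
at `S = {2}` for every `d ≥ 1` (`AbcOnCompactlyBoundedSubsets {2} d`; the (5.6.2) WLOG is the tree theorem
`Cor22.jInvVacuous_holds`). PROVED. [folklore] -/
theorem abcOnCompactlyBoundedSubsets_two_of_thm711Reduced (h : Thm711Reduced) {d : ℕ} (hd : 0 < d) :
    AbcOnCompactlyBoundedSubsets ({2} : Finset ℕ) d := fun ε hε K hK => by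
  obtain ⟨D', hD', hsub⟩ := jInvVacuous_holds K hK d hd
  exact (h D' hD' d hd ε hε).mono fun P hP => ⟨hsub hP, hP.2⟩

/-- Thm 7.1.1 (general display) on the one-member tripod family `(ℙ¹_ℚ, {0,1,∞})` IS the reduced form (cf. T-24's
`mainTheorem_tripod_of_corollary22`). PROVED. [folklore] -/
theorem thm711_tripod_iff : Thm711 (fun _ : PUnit.{1} => CurveHeightDatum.tripod) ↔ Thm711Reduced := by
  rw [thm711Reduced_iff_tripod]
  exact ⟨fun h => h PUnit.unit, fun h _ => h⟩

/-! ## 7. Junctions BY NAME (appended): T-30's verbatim Thm 6.1.1, and the tree's [IUTchIV] Thm 1.10 interface -/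

/-- **Bridge to T-30's typing of Thm 6.1.1** (`MainBoundDatum.Thm611`, [J-IV] p.58 l.1–23 verbatim over abstract reals): under
the dictionary identifications `log(q) = Cor22.logQAvoid P {2, ℓ}`, `log(𝔡^{L_tpd}) + log(𝔣^{L_tpd}) = logDiff + logCond` (p.75 l.18)
and `d_mod ≤ d` (`U(Q̄)_{≤d}`), Thm 6.1.1 as printed gives `Thm611Consumed` (`e*_mod = 2^12·3^3·5·e_mod ≤ δ` from the datum's
`e_mod ≤ d_mod`; the coefficient `1 + 20·d_mod/ℓ` is monotone). PROVED — the F6 substitution in kernel. [folklore] -/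
theorem thm611Consumed_of_mainBoundDatum (𝔐 : MainBoundDatum) (h : 𝔐.Thm611) {d : ℕ} (hdmod : 𝔐.dmod ≤ d)
    (P : NFPoint) (hq : 𝔐.logq = logQAvoid P {2, 𝔐.ell})
    (hLD : 𝔐.logDiffLtpd + 𝔐.logCondLtpd = P.logDiff + P.logCond) : Thm611Consumed d P 𝔐.ell := by
  have h1 := h.1
  unfold MainBoundDatum.boundLtpd MainBoundDatum.coeff at h1
  unfold Thm611Consumed
  rw [← hq, ← hLD]
  have hℓ : (0 : ℝ) < 𝔐.ell := by exact_mod_cast 𝔐.ell_prime.pos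
  have hd' : (𝔐.dmod : ℝ) ≤ d := by exact_mod_cast hdmod
  have he : (𝔐.emod : ℝ) ≤ 𝔐.dmod := by exact_mod_cast 𝔐.emod_le_dmod
  have hLD0 : 0 ≤ 𝔐.logDiffLtpd + 𝔐.logCondLtpd := add_nonneg 𝔐.logDiffLtpd_nonneg 𝔐.logCondLtpd_nonneg
  have hes : (𝔐.estar : ℝ) ≤ delta d := by
    unfold MainBoundDatum.estar delta; push_cast; nlinarith
  have hc : 20 * (𝔐.dmod : ℝ) / 𝔐.ell ≤ 20 * (d : ℝ) / 𝔐.ell :=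
    div_le_div_of_nonneg_right (by linarith) hℓ.le
  have h2 := mul_le_mul_of_nonneg_right hc hLD0
  have h3 := mul_le_mul_of_nonneg_right hes hℓ.le
  nlinarith [h1, h2, h3]

/-- **The reduced Thm 7.1.1 from the tree's [IUTchIV] Thm 1.10 interface ALONE** (`Cor22.Thm110Legendre`, a HYPOTHESIS resting
on the disputed [IUTchIII] Cor 3.12): via Mochizuki's own route Cor 2.2 ⟹ Cor 2.3 as proved in the tree
(`Cor22.vojtaP1Deg_of_thm110Legendre`, classical inputs `GenEll_thm21_primes_holds` / `fullGaloisImage_holds` /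
`jInvVacuous_holds` all tree theorems) and `thm711Reduced_of_vojtaP1Deg`. Compare E-t29's `thm711Reduced_of_thm110Legendre`,
which follows JOSHI'S §7.1 arithmetic and therefore carries his `η_prm = 60` (`IsEtaPrm 60`) as an extra hypothesis: the
two routes reach the same typed endpoint. An implication; nothing asserted. [folklore] -/
theorem thm711Reduced_of_thm110Legendre_cor22Route (h110 : Thm110Legendre) : Thm711Reduced :=
  thm711Reduced_of_vojtaP1Deg fun _ hd => vojtaP1Deg_of_thm110Legendre h110 GenEll_thm21_primes_holds hd

/-- **[J-IV] Thm 7.2.1 as typed ⟸ the tree's [IUTchIV] Thm 1.10 interface** (`Cor22.Thm110Legendre` — the ONE disputed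
input; no further hypothesis): Joshi's endpoint claim (abc 2.1.1 ∧ Szpiro 2.2.1) reduces in kernel to exactly the interface
Mochizuki's own [IUTchIV] §2 consumes. An implication between statements; NO abc claim. [folklore] -/
theorem thm721_of_thm110Legendre (h110 : Thm110Legendre) : Thm721 :=
  thm721_of_thm711Reduced (thm711Reduced_of_thm110Legendre_cor22Route h110)

end Summit.ABC.IUTFork.Joshi.ATS4

end
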